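import Summits.HodgeConjecture.CorCM.GaloisMetacyclicTwoPowerNondegenerate
import Summits.HodgeConjecture.CorCM.GaloisOddMetacyclicAllTypes
import Summits.HodgeConjecture.HodgeConjecture.Theorems.Ring2ClassTargets
import HarnessLib

/-!
# `Gal(K/ℚ) ≅ C_p ⋊_r C_{2^{a+j+1}}` (`r^{2^j} ≡ 1`, `1 ≤ j ≤ a + 1`), `2^{a+1} ∥ p^f − 1`: EVERY abelian variety with CM by
# `K` is stably nondegenerate — the Hodge conjecture for all powers, without simplicity

COR-CM (cell `pub-hodgecm2`), binder seat b04 (gen 27), count-neutral — the `2^j`-SHEET PROGRAMME, part (vii): the ALL-TYPES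
form of `CorCM/GaloisMetacyclicTwoPowerNondegenerate` through the Galois all-types engine
(`GaloisOddMetacyclic.isStablyNondegenerate_of_ringHom_metacyclic`, `k = a + j`: the proper subfields of `K` containing the
maximal totally real field are the cyclic `2`-power CM fields `K^{C_p}`, all of whose CM types are nondegenerate).  KERNEL
ONLY: theorems; no definition, no named fact, no `sorry`.  `HC_CM` is neither used nor claimed.

* `isStablyNondegenerate_of_ringHom_metacyclic_two_pow` (conditional on primitive ⟹ nondegenerate),
  **`isStablyNondegenerate_of_ringHom_of_pow_sub_one`**, `isStablyNondegenerate_of_ringHom_of_not_dvd`,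
  `hodgeConjectureFor_of_isIsogenous_powSucc_of_not_dvd`, `hodgeConjectureFor_powSucc_of_ringHom_of_not_dvd`,
  `isStablyNondegenerate_of_isCMTypeRealisation_of_not_dvd`, **`hodgeConjectureFor_pow_of_not_dvd`** (every power of EVERY
  abelian variety with CM by `K`, no simplicity), `hodgeConjectureFor_pow_of_pow_sub_one`,
  `hcOnClass_isIsogenous_powSucc_galoisCM_metacyclic_two_pow` (class-target display).

## References

* [Shimura1998] G. Shimura, *Abelian Varieties with Complex Multiplication and Modular Functions*, §5.1 Prop. 3, §8.2 Prop. 26.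
* [Gordon1999HodgeAVSurvey] B. B. Gordon, *A survey of the Hodge conjecture for abelian varieties*, Thm. 6.3–6.4, Def. 7.6.
* [Kubota1965] T. Kubota, Trans. AMS 118 (1965), §4 Lemma 2.
-/

noncomputable section

open CategoryTheory CategoryTheory.Limits NumberField

namespace Summit.HodgeConjecture.CorCM.GaloisMetacyclicTwoPower

open Literature.NumberTheory.ComplexMultiplication
open Literature.AlgebraicGeometry Literature.AlgebraicGeometry.Motives Literature.AlgebraicGeometry.HodgeTheory
open Literature.AlgebraicGeometry.Motives.AbelianVariety
open Literature.AlgebraicGeometry.ComplexMultiplication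
open Literature.AlgebraicGeometry.Pohlmann1968
open Summit.HodgeConjecture.CorCM.GaloisRank
open Summit.HodgeConjecture.HodgeConjecture.Ring2.ClassTargets

section Field

variable {p a : ℕ} [Fact p.Prime]
variable {K : Type} [Field K] [NumberField K] [IsCMField K] [IsGalois ℚ K]

/-- **THEOREM (ALL TYPES, conditional form).  `K` Galois CM with `Gal(K/ℚ) ≅ C_p ⋊_r C_{2^{a+j+1}}` (`p` odd,
`φ(1) v = v^r`, `r^{2^j} ≡ 1`) such that every PRIMITIVE CM type of `K` is nondegenerate: EVERY complex abelian variety `X` with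
`ψ : K →+* End⁰(X)` and `[K:ℚ] = 2 dim X` is STABLY NONDEGENERATE** — the case `k = a + j` of
`GaloisOddMetacyclic.isStablyNondegenerate_of_ringHom_metacyclic`. [cite: Shimura1998, §5.1 Prop. 3, §8.2 Prop. 26]
[cite: Gordon1999HodgeAVSurvey, Thm. 6.4 and Def. 7.6] -/
theorem isStablyNondegenerate_of_ringHom_metacyclic_two_pow (hp2 : p ≠ 2) {j : ℕ}
    (φ : Multiplicative (ZMod (2 ^ (a + j + 1))) →* MulAut (Multiplicative (ZMod p))) (r : ℕ)
    (hφ : ∀ v : Multiplicative (ZMod p), φ (Multiplicative.ofAdd 1) v = v ^ r) (hr : r ^ 2 ^ j % p = 1)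
    (e : (K ≃ₐ[ℚ] K) ≃* Multiplicative (ZMod p) ⋊[φ] Multiplicative (ZMod (2 ^ (a + j + 1))))
    (hprim : ∀ (Φ : CMType K) (φ₀ : K →+* ℂ), IsPrimitive (ℂ ≃+* ℂ) Φ.1 φ₀ → IsNondegenerate Φ)
    {X : AbelianVariety ℂ} (ψ : K →+* X.endAlgebra) (hX : Module.finrank ℚ K = 2 * X.dim) :
    IsStablyNondegenerate X :=
  GaloisOddMetacyclic.isStablyNondegenerate_of_ringHom_metacyclic (k := a + j) r hp2
    (pow_two_pow_add_mod_eq_one Fact.out r hr a) φ hφ e hprim ψ hX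

/-- **THEOREM (ALL TYPES).  `Gal(K/ℚ) ≅ C_p ⋊_r C_{2^{a+j+1}}` (`r^{2^j} ≡ 1`, `1 ≤ j ≤ a + 1`), `2^{a+1} ∣ p^f − 1`,
`2^{a+2} ∤ p^f − 1` for some `f`: EVERY complex abelian variety `X` with `K ↪ End⁰(X)` and `[K:ℚ] = 2 dim X` (dimension
`2^{a+j}p`) is STABLY NONDEGENERATE** — unconditionally. [cite: Shimura1998, §5.1 Prop. 3, §8.2 Prop. 26]
[cite: Gordon1999HodgeAVSurvey, Thm. 6.4 and Def. 7.6] -/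
theorem isStablyNondegenerate_of_ringHom_of_pow_sub_one {j : ℕ} (hj1 : 1 ≤ j) (hja : j ≤ a + 1) {f : ℕ}
    (hf1 : 2 ^ (a + 1) ∣ p ^ f - 1) (hf2 : ¬ 2 ^ (a + 2) ∣ p ^ f - 1)
    (φ : Multiplicative (ZMod (2 ^ (a + j + 1))) →* MulAut (Multiplicative (ZMod p))) (r : ℕ)
    (hφ : ∀ v : Multiplicative (ZMod p), φ (Multiplicative.ofAdd 1) v = v ^ r) (hr : r ^ 2 ^ j % p = 1)
    (e : (K ≃ₐ[ℚ] K) ≃* Multiplicative (ZMod p) ⋊[φ] Multiplicative (ZMod (2 ^ (a + j + 1))))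
    {X : AbelianVariety ℂ} (ψ : K →+* X.endAlgebra) (hX : Module.finrank ℚ K = 2 * X.dim) :
    IsStablyNondegenerate X :=
  isStablyNondegenerate_of_ringHom_metacyclic_two_pow (ne_two_of_two_pow_dvd_pow_sub_one hf1 hf2) φ r hφ hr e
    (fun _ φ₀ hprim => isNondegenerate_of_isPrimitive_of_pow_sub_one hj1 hja hf1 hf2 φ r hφ hr e φ₀ hprim) ψ hX

/-- **THEOREM (ALL TYPES, closed form): `p` odd, `2^{a+2} ∤ p − 1`, `2^{a+1} ∤ p + 1` ⟹ every `X` with `K ↪ End⁰(X)`,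
`[K:ℚ] = 2 dim X`, is stably nondegenerate.** [cite: Shimura1998, §5.1 Prop. 3, §8.2 Prop. 26]
[cite: Gordon1999HodgeAVSurvey, Thm. 6.4 and Def. 7.6] -/
theorem isStablyNondegenerate_of_ringHom_of_not_dvd (hp2 : p ≠ 2) {j : ℕ} (hj1 : 1 ≤ j) (hja : j ≤ a + 1)
    (h1 : ¬ 2 ^ (a + 2) ∣ p - 1) (h2 : ¬ 2 ^ (a + 1) ∣ p + 1)
    (φ : Multiplicative (ZMod (2 ^ (a + j + 1))) →* MulAut (Multiplicative (ZMod p))) (r : ℕ)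
    (hφ : ∀ v : Multiplicative (ZMod p), φ (Multiplicative.ofAdd 1) v = v ^ r) (hr : r ^ 2 ^ j % p = 1)
    (e : (K ≃ₐ[ℚ] K) ≃* Multiplicative (ZMod p) ⋊[φ] Multiplicative (ZMod (2 ^ (a + j + 1))))
    {X : AbelianVariety ℂ} (ψ : K →+* X.endAlgebra) (hX : Module.finrank ℚ K = 2 * X.dim) :
    IsStablyNondegenerate X :=
  isStablyNondegenerate_of_ringHom_metacyclic_two_pow hp2 φ r hφ hr e
    (fun _ φ₀ hprim => isNondegenerate_of_isPrimitive_of_not_dvd hp2 hj1 hja h1 h2 φ r hφ hr e φ₀ hprim) ψ hX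

/-- **The Hodge conjecture for everything isogenous to a power of such an `X`** — no simplicity. UNCONDITIONAL.
[cite: Gordon1999HodgeAVSurvey, Thm. 6.3–6.4] -/
theorem hodgeConjectureFor_of_isIsogenous_powSucc_of_not_dvd (hp2 : p ≠ 2) {j : ℕ} (hj1 : 1 ≤ j) (hja : j ≤ a + 1)
    (h1 : ¬ 2 ^ (a + 2) ∣ p - 1) (h2 : ¬ 2 ^ (a + 1) ∣ p + 1)
    (φ : Multiplicative (ZMod (2 ^ (a + j + 1))) →* MulAut (Multiplicative (ZMod p))) (r : ℕ)
    (hφ : ∀ v : Multiplicative (ZMod p), φ (Multiplicative.ofAdd 1) v = v ^ r) (hr : r ^ 2 ^ j % p = 1)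
    (e : (K ≃ₐ[ℚ] K) ≃* Multiplicative (ZMod p) ⋊[φ] Multiplicative (ZMod (2 ^ (a + j + 1))))
    {X : AbelianVariety ℂ} (ψ : K →+* X.endAlgebra) (hX : Module.finrank ℚ K = 2 * X.dim)
    {B : AbelianVariety ℂ} {N : ℕ} (h : IsIsogenous B (X.powSucc N)) : HodgeConjectureFor B.dim B.X :=
  (isStablyNondegenerate_of_ringHom_of_not_dvd hp2 hj1 hja h1 h2 φ r hφ hr e ψ hX).hodgeConjectureFor_of_isIsogenous_powSucc h

/-- The Hodge conjecture for every power `X^{N+1}`. [cite: Gordon1999HodgeAVSurvey, Thm. 6.4 and Def. 7.6] -/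
theorem hodgeConjectureFor_powSucc_of_ringHom_of_not_dvd (hp2 : p ≠ 2) {j : ℕ} (hj1 : 1 ≤ j) (hja : j ≤ a + 1)
    (h1 : ¬ 2 ^ (a + 2) ∣ p - 1) (h2 : ¬ 2 ^ (a + 1) ∣ p + 1)
    (φ : Multiplicative (ZMod (2 ^ (a + j + 1))) →* MulAut (Multiplicative (ZMod p))) (r : ℕ)
    (hφ : ∀ v : Multiplicative (ZMod p), φ (Multiplicative.ofAdd 1) v = v ^ r) (hr : r ^ 2 ^ j % p = 1)
    (e : (K ≃ₐ[ℚ] K) ≃* Multiplicative (ZMod p) ⋊[φ] Multiplicative (ZMod (2 ^ (a + j + 1))))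
    {X : AbelianVariety ℂ} (ψ : K →+* X.endAlgebra) (hX : Module.finrank ℚ K = 2 * X.dim) (N : ℕ) :
    HodgeConjectureFor (X.powSucc N).dim (X.powSucc N).X :=
  (isStablyNondegenerate_of_ringHom_of_not_dvd hp2 hj1 hja h1 h2 φ r hφ hr e ψ hX).hodgeConjectureFor_powSucc N

variable {Φ : CMType K} {A : AbelianVariety ℂ} {ι : 𝓞 K →+* End A} {θ : K →+* Module.End ℂ (complexBetti A.X 1)}

/-- **Realisation form**: every abelian variety `(A, ι)` of ANY CM type `(K; Φ)` is stably nondegenerate, for `p` odd,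
`2^{a+2} ∤ p − 1`, `2^{a+1} ∤ p + 1`. [cite: Shimura1998, §5.1–5.2] [cite: Gordon1999HodgeAVSurvey, Thm. 6.4] -/
theorem isStablyNondegenerate_of_isCMTypeRealisation_of_not_dvd (hp2 : p ≠ 2) {j : ℕ} (hj1 : 1 ≤ j) (hja : j ≤ a + 1)
    (h1 : ¬ 2 ^ (a + 2) ∣ p - 1) (h2 : ¬ 2 ^ (a + 1) ∣ p + 1)
    (φ : Multiplicative (ZMod (2 ^ (a + j + 1))) →* MulAut (Multiplicative (ZMod p))) (r : ℕ)
    (hφ : ∀ v : Multiplicative (ZMod p), φ (Multiplicative.ofAdd 1) v = v ^ r) (hr : r ^ 2 ^ j % p = 1)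
    (e : (K ≃ₐ[ℚ] K) ≃* Multiplicative (ZMod p) ⋊[φ] Multiplicative (ZMod (2 ^ (a + j + 1))))
    (hA : IsCMTypeRealisation Φ A ι θ) : IsStablyNondegenerate A := by
  obtain ⟨i, -⟩ := exists_ringHom_endAlgebra ι
  exact isStablyNondegenerate_of_ringHom_of_not_dvd hp2 hj1 hja h1 h2 φ r hφ hr e i
    (finrank_eq_two_mul_dim_of_isCMTypeRealisation hA)

/-- **THE HODGE CONJECTURE FOR EVERY POWER OF EVERY ABELIAN VARIETY WITH CM BY A GALOIS CM FIELD WITH GROUP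
`C_p ⋊_r C_{2^{a+j+1}}` (`r^{2^j} ≡ 1`, `1 ≤ j ≤ a + 1`), `p` odd, `2^{a+2} ∤ p − 1`, `2^{a+1} ∤ p + 1`** —
`hodgeConjectureFor_pow_of_isSimple_of_not_dvd` WITHOUT `A.IsSimple`. UNCONDITIONAL. [cite: Gordon1999HodgeAVSurvey, Thm. 6.4]
[cite: Shimura1998, §5.1 Prop. 3 and §8.2 Prop. 26] -/
theorem hodgeConjectureFor_pow_of_not_dvd (hp2 : p ≠ 2) {j : ℕ} (hj1 : 1 ≤ j) (hja : j ≤ a + 1)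
    (h1 : ¬ 2 ^ (a + 2) ∣ p - 1) (h2 : ¬ 2 ^ (a + 1) ∣ p + 1)
    (φ : Multiplicative (ZMod (2 ^ (a + j + 1))) →* MulAut (Multiplicative (ZMod p))) (r : ℕ)
    (hφ : ∀ v : Multiplicative (ZMod p), φ (Multiplicative.ofAdd 1) v = v ^ r) (hr : r ^ 2 ^ j % p = 1)
    (e : (K ≃ₐ[ℚ] K) ≃* Multiplicative (ZMod p) ⋊[φ] Multiplicative (ZMod (2 ^ (a + j + 1))))
    (hA : IsCMTypeRealisation Φ A ι θ) (N : ℕ) :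
    HodgeConjectureFor (⨁ fun _ : Fin N => A).dim (⨁ fun _ : Fin N => A).X :=
  hodgeConjectureFor_of_isDivisorGenerated _
    ((isStablyNondegenerate_iff_forall_isDivisorGenerated_biproduct A).1
      (isStablyNondegenerate_of_isCMTypeRealisation_of_not_dvd hp2 hj1 hja h1 h2 φ r hφ hr e hA) N)

/-- Realisation form with the residue-field hypotheses `2^{a+1} ∣ p^f − 1`, `2^{a+2} ∤ p^f − 1`.
[cite: Shimura1998, §5.1–5.2] [cite: Gordon1999HodgeAVSurvey, Thm. 6.4] -/
theorem hodgeConjectureFor_pow_of_pow_sub_one {j : ℕ} (hj1 : 1 ≤ j) (hja : j ≤ a + 1) {f : ℕ}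
    (hf1 : 2 ^ (a + 1) ∣ p ^ f - 1) (hf2 : ¬ 2 ^ (a + 2) ∣ p ^ f - 1)
    (φ : Multiplicative (ZMod (2 ^ (a + j + 1))) →* MulAut (Multiplicative (ZMod p))) (r : ℕ)
    (hφ : ∀ v : Multiplicative (ZMod p), φ (Multiplicative.ofAdd 1) v = v ^ r) (hr : r ^ 2 ^ j % p = 1)
    (e : (K ≃ₐ[ℚ] K) ≃* Multiplicative (ZMod p) ⋊[φ] Multiplicative (ZMod (2 ^ (a + j + 1))))
    (hA : IsCMTypeRealisation Φ A ι θ) (N : ℕ) :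
    HodgeConjectureFor (⨁ fun _ : Fin N => A).dim (⨁ fun _ : Fin N => A).X := by
  obtain ⟨i, -⟩ := exists_ringHom_endAlgebra ι
  exact hodgeConjectureFor_of_isDivisorGenerated _
    ((isStablyNondegenerate_iff_forall_isDivisorGenerated_biproduct A).1
      (isStablyNondegenerate_of_ringHom_of_pow_sub_one hj1 hja hf1 hf2 φ r hφ hr e i
        (finrank_eq_two_mul_dim_of_isCMTypeRealisation hA)) N)

end Field

/-! ## Class-target display -/

/-- **HC on the class «isogenous to a power of an abelian variety `X` with an action of a Galois CM field `K`,
`Gal(K/ℚ) ≅ C_p ⋊_r C_{2^{a+j+1}}` (`φ(1) v = v^r`, `r^{2^j} ≡ 1 (mod p)`, `1 ≤ j ≤ a + 1`), `p` odd, `2^{a+2} ∤ p − 1`,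
`2^{a+1} ∤ p + 1`, `[K:ℚ] = 2 dim X`»** — UNCONDITIONAL, NO simplicity. [cite: Gordon1999HodgeAVSurvey, Thm. 6.3–6.4] -/
theorem hcOnClass_isIsogenous_powSucc_galoisCM_metacyclic_two_pow :
    HCOnClass fun B ↦ ∃ (X : AbelianVariety ℂ) (N : ℕ) (K : Type) (_ : Field K) (_ : NumberField K)
      (_ : IsCMField K) (_ : IsGalois ℚ K) (p a j r : ℕ) (_ : Fact p.Prime)
      (φ : Multiplicative (ZMod (2 ^ (a + j + 1))) →* MulAut (Multiplicative (ZMod p)))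
      (_ : (K ≃ₐ[ℚ] K) ≃* Multiplicative (ZMod p) ⋊[φ] Multiplicative (ZMod (2 ^ (a + j + 1)))),
      p ≠ 2 ∧ 1 ≤ j ∧ j ≤ a + 1 ∧ (∀ v : Multiplicative (ZMod p), φ (Multiplicative.ofAdd 1) v = v ^ r) ∧
      r ^ 2 ^ j % p = 1 ∧ ¬ 2 ^ (a + 2) ∣ p - 1 ∧ ¬ 2 ^ (a + 1) ∣ p + 1 ∧ Module.finrank ℚ K = 2 * X.dim ∧
      Nonempty (K →+* X.endAlgebra) ∧ IsIsogenous B (X.powSucc N) := by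
  rintro B ⟨X, N, K, _, _, _, _, p, a, j, r, _, φ, e, hp2, hj1, hja, hφ, hr, h1, h2, hX, ⟨ψ⟩, h⟩
  exact hodgeConjectureFor_of_isIsogenous_powSucc_of_not_dvd hp2 hj1 hja h1 h2 φ r hφ hr e ψ hX h

end Summit.HodgeConjecture.CorCM.GaloisMetacyclicTwoPower

end
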